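import Literature.NumberTheory.LFunctions.Zhang2022.KnifeEdgeLenLongLegChiWindow

/-!
# Route `ZDegreeToeplitzBand`, crux h2′ `PsiGradedTablesClosePoly` (stmt-Parity-22438), line `long_poly_dil`
# (skeleton 7f182f1dab96ad01), stub 1 `stub_formulaILongPsiDil` — SLOT ALGEBRA toward the stub (helpers, `--supports`)

The registered stub is `∃ c₀, ∀ c′ ≥ c₀, LongLegSplit.FormulaILongPsiDil c′` (Leg A re-typed over the `D`-dilated head
class, `Zhang2022/KnifeEdgeLenLongLegChiWindow.lean` Part 4, p564811): Proposition 7.1's conclusion for the long ψ-datum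
`𝐚₁ = dilHead D b₀ ⋆ (χg̃) ⋆ (χf̃)` (ψ-side truncation `Nlong D = D⁵(⌊P⌋+1)²`) against divisor-class k-side data, slack
`ε·√D·𝔓`. It is NOT proved here (it is Prop. 7.1 re-run on a class that the tree's theorem
`Section7cStatements.prop71X_holds : ∀ c′, Skeleton.Prop71 c′` does not cover: `Skeleton.Prop71` binds `Adm72 D B` data with
the truncation `Nsupp D = ⌈PT⁻²⌉` on both sides). What this file lands, kernel-checked, for whoever proves or consumes it:

* Part 1 — homogeneity of the long ψ-datum in the DILATED head (`dilHead_const_mul`, `longPsiData_dilHead_const_mul`);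
  the homogeneity of `Theta1Ext` / `SjExt` / `EcalExt` / `mainMVExt` in either datum is the tree's
  (`LongPairsGradedTables/Negative/LegSplitAmplitude.*_const_mul_left`, p545732; `…/LegSplitAmplitudeDual.*_const_mul_right`)
  — copied PRIVATELY below so that this file imports no route-dependent module (theses-cone hygiene, as in
  `…/Negative/DilCompanions.lean`).
* Part 2 — **the `∀ B` binder of the slot is idle**: `FormulaILongPsiDil c′` is EQUIVALENT to its unit-class instance
  (`‖b₀(n)‖ ≤ τ(n)²`, `‖𝐚₂(n)‖ ≤ τ(n)`; `formulaILongPsiDil_iff_unit`) — both sides of the estimate are jointly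
  homogeneous of degree 2 in `(b₀, 𝐚₂)`, the slack absorbs `max(B,1)²` into `ε`. Hence the registered stub is equivalent
  to the eventual unit-class estimate (`stub_formulaILongPsiDil_iff_unit`), and follows from it (`…_of_unit`).
* Part 3 — what the undilated slot K2 `FormulaILongPsi` supplies on the dilated class, for the record: heads
  `dilHead D b₀` lie in K2's sup-amplitude class at amplitude `D` (`dilHead_norm_le`), so K2 gives the formula-I estimate
  for them with slack `ε·D·𝔓` against `Adm72` k-side data (`formulaILongPsi_dilHead`; = p545732's `formulaILongPsi_amp` at `A = D`);
  the stub's slot differs in exactly the slack (`ε·√D·𝔓`) and the k-side class (divisor class) — the two binders that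
  make it a separate analytic claim (Prop. 7.1 re-run, (7.3)–(7.21), for the dilated long class).

Nothing here asserts the slot; standard axioms; no new definition. Prover: ls-knife-typer-1 g19 (P1 WAKE, cell
landau-siegel §D). «The programme SEARCHES and TYPES; no claim about Landau–Siegel zeros, Theorems 1–2 of
arXiv:2211.02515 or a repaired Margin232 until a kernel theorem says so.»

## References
* [Zhang2022LandauSiegel] Y. Zhang, Discrete mean estimates and the Landau–Siegel zero, arXiv:2211.02515v1 (2022):
  §7 Prop. 7.1, (7.1)–(7.2) p. 13; §8 Lemma 8.1, (8.8) p. 16.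
-/

noncomputable section

namespace Summit.Parity.GeneralizedHardyLittlewood.Theorems

open Complex Real ComplexConjugate Finset
open Literature.NumberTheory.LFunctions.Zhang2022
open Literature.NumberTheory.LFunctions.Zhang2022.Skeleton
open Literature.NumberTheory.LFunctions.Zhang2022.KnifeEdge
open Literature.NumberTheory.LFunctions.Zhang2022.KnifeEdge.LongLegSplit

/-! ### Part 0 — private copies of the tree's homogeneity lemmas (public twins: `LegSplitAmplitude{,Dual}`) -/

section Copies

variable (c' : ℝ) {D : ℕ} (χ : DirichletCharacter ℂ D)

/-- (private copy) `A(c·𝐚;s,ψ) = c·A(𝐚;s,ψ)`. [cite: Zhang2022LandauSiegel, §7 p. 13] -/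
private theorem dirPoly_const_mul' {k : ℕ} (N : ℕ) (c : ℂ) (a : ℕ → ℂ) (ψ : DirichletCharacter ℂ k) (s : ℂ) :
    Lemma81.dirPoly N (fun n => c * a n) ψ s = c * Lemma81.dirPoly N a ψ s := by
  simp only [Lemma81.dirPoly_def, Finset.mul_sum]
  exact Finset.sum_congr rfl fun n _ => by ring

/-- (private copy) the segment integral is linear in the integrand. [cite: Zhang2022LandauSiegel, §7 p. 13] -/
private theorem segInt_const_mul' (t₀ L₁ : ℝ) (z c : ℂ) (F : ℂ → ℂ) :
    Lemma81.segInt t₀ L₁ z (fun s => c * F s) = c * Lemma81.segInt t₀ L₁ z F := by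
  simp only [Lemma81.segInt_def]
  rw [intervalIntegral.integral_const_mul]
  ring

/-- (private copy) `Θ₁` with extended truncations is linear in `𝐚₁`. [cite: Zhang2022LandauSiegel, §7 Prop. 7.1 p. 13] -/
private theorem Theta1Ext_const_mul_left' (N₁ N₂ : ℕ) (c : ℂ) (a₁ a₂ : ℕ → ℂ) :
    Theta1Ext c' χ N₁ N₂ (fun n => c * a₁ n) a₂ = c * Theta1Ext c' χ N₁ N₂ a₁ a₂ := by
  unfold Theta1Ext
  rw [Finset.mul_sum]
  refine Finset.sum_congr rfl fun x _ => ?_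
  rw [← segInt_const_mul']
  congr 1
  funext s
  rw [dirPoly_const_mul']
  ring

/-- (private copy) `Θ₁` with extended truncations is linear in `𝐚₂`. [cite: Zhang2022LandauSiegel, §7 Prop. 7.1 p. 13] -/
private theorem Theta1Ext_const_mul_right' (N₁ N₂ : ℕ) (c : ℂ) (a₁ a₂ : ℕ → ℂ) :
    Theta1Ext c' χ N₁ N₂ a₁ (fun n => c * a₂ n) = c * Theta1Ext c' χ N₁ N₂ a₁ a₂ := by
  unfold Theta1Ext
  rw [Finset.mul_sum]
  refine Finset.sum_congr rfl fun x _ => ?_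
  rw [← segInt_const_mul']
  congr 1
  funext s
  rw [dirPoly_const_mul']
  ring

/-- (private copy) `S_j` with extended ranges is linear in `𝐚₁`. [cite: Zhang2022LandauSiegel, §7 Prop. 7.1 p. 13] -/
private theorem SjExt_const_mul_left' (D N₁ N₂ j : ℕ) (c : ℂ) (a₁ a₂ : ℕ → ℂ) :
    SjExt c' D N₁ N₂ j (fun n => c * a₁ n) a₂ = c * SjExt c' D N₁ N₂ j a₁ a₂ := by
  unfold SjExt
  rw [Finset.mul_sum]
  refine Finset.sum_congr rfl fun d _ => ?_
  rw [Finset.mul_sum]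
  refine Finset.sum_congr rfl fun r _ => ?_
  have hm : (∑ m ∈ Finset.Ico 1 N₁, c * a₁ (d * r * m) / (m : ℂ) ^ (1 - betaJ c' D j))
      = c * ∑ m ∈ Finset.Ico 1 N₁, a₁ (d * r * m) / (m : ℂ) ^ (1 - betaJ c' D j) := by
    rw [Finset.mul_sum]
    exact Finset.sum_congr rfl fun m _ => by ring
  rw [hm]
  ring

/-- (private copy) `S_j` with extended ranges is linear in `𝐚₂`. [cite: Zhang2022LandauSiegel, §7 Prop. 7.1 p. 13] -/
private theorem SjExt_const_mul_right' (D N₁ N₂ j : ℕ) (c : ℂ) (a₁ a₂ : ℕ → ℂ) :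
    SjExt c' D N₁ N₂ j a₁ (fun n => c * a₂ n) = c * SjExt c' D N₁ N₂ j a₁ a₂ := by
  unfold SjExt
  rw [Finset.mul_sum]
  refine Finset.sum_congr rfl fun d _ => ?_
  rw [Finset.mul_sum]
  refine Finset.sum_congr rfl fun r _ => ?_
  have hn : (∑ n ∈ Finset.Ico 1 N₂, c * a₂ (d * r * n) * xiZero c' D j n d r / (n : ℂ))
      = c * ∑ n ∈ Finset.Ico 1 N₂, a₂ (d * r * n) * xiZero c' D j n d r / (n : ℂ) := by
    rw [Finset.mul_sum]
    exact Finset.sum_congr rfl fun n _ => by ring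
  rw [hn]
  ring

/-- (private copy) `E` with extended ranges is absolutely homogeneous in `𝐚₁` and in `𝐚₂`.
[cite: Zhang2022LandauSiegel, §7 Prop. 7.1 p. 13] -/
private theorem EcalExt_const_mul_both' (D N₁ N₂ : ℕ) (c : ℂ) (a₁ a₂ : ℕ → ℂ) :
    EcalExt c' D N₁ N₂ (fun n => c * a₁ n) (fun n => c * a₂ n) = ‖c‖ * ‖c‖ * EcalExt c' D N₁ N₂ a₁ a₂ := by
  unfold EcalExt
  simp only [SjExt_const_mul_left', SjExt_const_mul_right', norm_mul]
  ring

/-- (private copy) the main term with extended ranges is linear in `𝐚₁` and in `𝐚₂`.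
[cite: Zhang2022LandauSiegel, §7 Prop. 7.1 p. 13] -/
private theorem mainMVExt_const_mul_both' (D N₁ N₂ : ℕ) (c : ℂ) (a₁ a₂ : ℕ → ℂ) :
    mainMVExt c' D N₁ N₂ (fun n => c * a₁ n) (fun n => c * a₂ n) = c * c * mainMVExt c' D N₁ N₂ a₁ a₂ := by
  unfold mainMVExt
  simp only [SjExt_const_mul_left', SjExt_const_mul_right']
  ring

/-- (private copy) `E` is absolutely homogeneous in `𝐚₁`. [cite: Zhang2022LandauSiegel, §7 Prop. 7.1 p. 13] -/
private theorem EcalExt_const_mul_left' (D N₁ N₂ : ℕ) (c : ℂ) (a₁ a₂ : ℕ → ℂ) :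
    EcalExt c' D N₁ N₂ (fun n => c * a₁ n) a₂ = ‖c‖ * EcalExt c' D N₁ N₂ a₁ a₂ := by
  unfold EcalExt
  simp only [SjExt_const_mul_left', norm_mul]
  ring

/-- (private copy) the main term is linear in `𝐚₁`. [cite: Zhang2022LandauSiegel, §7 Prop. 7.1 p. 13] -/
private theorem mainMVExt_const_mul_left' (D N₁ N₂ : ℕ) (c : ℂ) (a₁ a₂ : ℕ → ℂ) :
    mainMVExt c' D N₁ N₂ (fun n => c * a₁ n) a₂ = c * mainMVExt c' D N₁ N₂ a₁ a₂ := by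
  unfold mainMVExt
  simp only [SjExt_const_mul_left']
  ring

/-- (private copy) `𝐚₁ = b ⋆ (χg̃) ⋆ (χf̃)` is linear in `b`, as a function. [cite: Zhang2022LandauSiegel, §8 (8.8) p. 16] -/
private theorem longPsiData_const_mul_fun' (c : ℂ) (b : ℕ → ℂ) (g f : ℝ → ℂ) :
    longPsiData χ (fun m => c * b m) g f = fun n => c * longPsiData χ b g f n :=
  funext fun n => longPsiData_const_mul χ c b g f n

end Copies

/-! ### Part 1 — homogeneity of the long ψ-datum in the dilated head -/

section Homogeneity

variable (c' : ℝ) {D : ℕ} (χ : DirichletCharacter ℂ D)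

/-- The dilated head is linear in the undilated head: `dilHead D (c·b₀) = c·dilHead D b₀`.
[cite: Zhang2022LandauSiegel, §8 (8.8) p. 16] -/
theorem dilHead_const_mul (D : ℕ) (c : ℂ) (b₀ : ℕ → ℂ) :
    dilHead D (fun n => c * b₀ n) = fun d => c * dilHead D b₀ d := by
  funext d
  unfold dilHead
  split_ifs <;> ring

/-- The long ψ-datum with a dilated head is linear in the undilated head.
[cite: Zhang2022LandauSiegel, §8 (8.8) p. 16] -/
theorem longPsiData_dilHead_const_mul (c : ℂ) (b₀ : ℕ → ℂ) (g f : ℝ → ℂ) :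
    longPsiData χ (dilHead D (fun n => c * b₀ n)) g f = fun n => c * longPsiData χ (dilHead D b₀) g f n := by
  rw [dilHead_const_mul]
  exact longPsiData_const_mul_fun' χ c (dilHead D b₀) g f

end Homogeneity

/-! ### Part 2 — the unit-class normal form of `FormulaILongPsiDil` -/

section UnitClass

variable (c' : ℝ)

/-- **`FormulaILongPsiDil c′` ⇔ its unit-class instance (`B = 1`).** The estimate is jointly 2-homogeneous in
`(b₀, 𝐚₂)` (`Θ₁`, the main term and `E`, Parts 0–1), so the class bound `B` (fixed before
`ForAllLarge`) is absorbed into `ε`: apply the unit-class estimate with `ε / max(B,1)²` to `(b₀/B′, 𝐚₂/B′)`, `B′ = max(B,1)`.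
[cite: Zhang2022LandauSiegel, §7 Prop. 7.1, (7.2) p. 13] -/
theorem formulaILongPsiDil_iff_unit :
    FormulaILongPsiDil c' ↔
    ∀ ε : ℝ, 0 < ε → ∃ C : ℝ, ForAllLarge fun D _ χ => AssumptionA D χ →
      ∀ (b₀ : ℕ → ℂ) (g g' f f' : ℝ → ℂ) (a₂ : ℕ → ℂ),
        InClassPiece g g' → InClassPiece f f' →
        (∀ x ∈ Set.Icc (0:ℝ) 1, ‖g x‖ ≤ 1) → (∀ x ∈ Set.Icc (0:ℝ) 1, ‖f x‖ ≤ 1) →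
        (∀ n, ‖b₀ n‖ ≤ ((Nat.divisors n).card : ℝ) ^ 2) → (∀ n : ℕ, D ^ 4 < n → b₀ n = 0) →
        (∀ n, ‖a₂ n‖ ≤ ((Nat.divisors n).card : ℝ)) → (∀ n : ℕ, D ^ 4 < n → a₂ n = 0) →
          ‖Theta1Ext c' χ (Nlong D) (Nsupp D) (longPsiData χ (dilHead D b₀) g f) a₂
              - mainMVExt c' D (Nlong D) (Nsupp D) (longPsiData χ (dilHead D b₀) g f) a₂‖
            ≤ C * EcalExt c' D (Nlong D) (Nsupp D) (longPsiData χ (dilHead D b₀) g f) a₂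
              + ε * Real.sqrt D * frakP D := by
  constructor
  · -- `B = 1`
    intro h ε hε
    obtain ⟨C, D₀, hD₀⟩ := h 1 ε hε
    refine ⟨C, D₀, fun D _ χ hD hq hp hA b₀ g g' f f' a₂ hg hf hg1 hf1 hb hb0 ha ha0 => ?_⟩
    exact hD₀ D χ hD hq hp hA b₀ g g' f f' a₂ hg hf hg1 hf1 (fun n => by rw [one_mul]; exact hb n) hb0
      (fun n => by rw [one_mul]; exact ha n) ha0
  · intro h B ε hε
    -- normalise by `B′ = max B 1 > 0`
    set B' : ℝ := max B 1 with hB'def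
    have hB'pos : 0 < B' := lt_of_lt_of_le one_pos (le_max_right _ _)
    have hBB' : B ≤ B' := le_max_left _ _
    have hε' : 0 < ε / B' ^ 2 := div_pos hε (pow_pos hB'pos 2)
    obtain ⟨C, D₀, hD₀⟩ := h (ε / B' ^ 2) hε'
    refine ⟨C, D₀, fun D _ χ hD hq hp hA b₀ g g' f f' a₂ hg hf hg1 hf1 hb hb0 ha ha0 => ?_⟩
    -- the rescaled data lie in the unit class
    have hτ : ∀ n : ℕ, (0 : ℝ) ≤ ((Nat.divisors n).card : ℝ) := fun n => Nat.cast_nonneg _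
    have hb' : ∀ n, ‖(B' : ℂ)⁻¹ * b₀ n‖ ≤ ((Nat.divisors n).card : ℝ) ^ 2 := by
      intro n
      rw [norm_mul, norm_inv, Complex.norm_real, Real.norm_eq_abs, abs_of_pos hB'pos,
        inv_mul_le_iff₀ hB'pos]
      exact (hb n).trans (mul_le_mul_of_nonneg_right hBB' (pow_nonneg (hτ n) 2))
    have ha' : ∀ n, ‖(B' : ℂ)⁻¹ * a₂ n‖ ≤ ((Nat.divisors n).card : ℝ) := by
      intro n
      rw [norm_mul, norm_inv, Complex.norm_real, Real.norm_eq_abs, abs_of_pos hB'pos,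
        inv_mul_le_iff₀ hB'pos]
      exact (ha n).trans (mul_le_mul_of_nonneg_right hBB' (hτ n))
    have hb'0 : ∀ n : ℕ, D ^ 4 < n → (B' : ℂ)⁻¹ * b₀ n = 0 := fun n hn => by rw [hb0 n hn, mul_zero]
    have ha'0 : ∀ n : ℕ, D ^ 4 < n → (B' : ℂ)⁻¹ * a₂ n = 0 := fun n hn => by rw [ha0 n hn, mul_zero]
    have key := hD₀ D χ hD hq hp hA (fun n => (B' : ℂ)⁻¹ * b₀ n) g g' f f' (fun n => (B' : ℂ)⁻¹ * a₂ n)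
      hg hf hg1 hf1 hb' hb'0 ha' ha'0
    rw [longPsiData_dilHead_const_mul, Theta1Ext_const_mul_left', Theta1Ext_const_mul_right',
      mainMVExt_const_mul_both', EcalExt_const_mul_both', ← mul_assoc, ← mul_sub, norm_mul, norm_mul, norm_inv,
      Complex.norm_real, Real.norm_eq_abs, abs_of_pos hB'pos] at key
    -- key : B′⁻¹·B′⁻¹·‖Θ − M‖ ≤ C·(B′⁻¹·B′⁻¹·E) + (ε/B′²)·√D·𝔓; multiply through by `B′²`
    set T := ‖Theta1Ext c' χ (Nlong D) (Nsupp D) (longPsiData χ (dilHead D b₀) g f) a₂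
        - mainMVExt c' D (Nlong D) (Nsupp D) (longPsiData χ (dilHead D b₀) g f) a₂‖ with hT
    set E := EcalExt c' D (Nlong D) (Nsupp D) (longPsiData χ (dilHead D b₀) g f) a₂ with hE
    have hB2 : (0 : ℝ) < B' ^ 2 := pow_pos hB'pos 2
    have hmul := mul_le_mul_of_nonneg_left key hB2.le
    have h1 : B' ^ 2 * (B'⁻¹ * B'⁻¹ * T) = T := by field_simp
    have h2 : B' ^ 2 * (C * (B'⁻¹ * B'⁻¹ * E) + ε / B' ^ 2 * Real.sqrt D * frakP D)
        = C * E + ε * Real.sqrt D * frakP D := by field_simp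
    rwa [h1, h2] at hmul

/-- **The registered stub in unit-class form:** `(∃ c₀, ∀ c′ ≥ c₀, FormulaILongPsiDil c′)` — the signature of
`stub_formulaILongPsiDil` of `Cruxes/PsiGradedTablesClosePoly/Lines/long_poly_dil.lean` — is equivalent to the eventual
unit-class estimate. [cite: Zhang2022LandauSiegel, §7 Prop. 7.1, (7.2) p. 13] -/
theorem stub_formulaILongPsiDil_iff_unit :
    (∃ c₀ : ℝ, ∀ c' : ℝ, c₀ ≤ c' → FormulaILongPsiDil c') ↔
    ∃ c₀ : ℝ, ∀ c' : ℝ, c₀ ≤ c' →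
      ∀ ε : ℝ, 0 < ε → ∃ C : ℝ, ForAllLarge fun D _ χ => AssumptionA D χ →
        ∀ (b₀ : ℕ → ℂ) (g g' f f' : ℝ → ℂ) (a₂ : ℕ → ℂ),
          InClassPiece g g' → InClassPiece f f' →
          (∀ x ∈ Set.Icc (0:ℝ) 1, ‖g x‖ ≤ 1) → (∀ x ∈ Set.Icc (0:ℝ) 1, ‖f x‖ ≤ 1) →
          (∀ n, ‖b₀ n‖ ≤ ((Nat.divisors n).card : ℝ) ^ 2) → (∀ n : ℕ, D ^ 4 < n → b₀ n = 0) →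
          (∀ n, ‖a₂ n‖ ≤ ((Nat.divisors n).card : ℝ)) → (∀ n : ℕ, D ^ 4 < n → a₂ n = 0) →
            ‖Theta1Ext c' χ (Nlong D) (Nsupp D) (longPsiData χ (dilHead D b₀) g f) a₂
                - mainMVExt c' D (Nlong D) (Nsupp D) (longPsiData χ (dilHead D b₀) g f) a₂‖
              ≤ C * EcalExt c' D (Nlong D) (Nsupp D) (longPsiData χ (dilHead D b₀) g f) a₂
                + ε * Real.sqrt D * frakP D := by
  constructor
  · rintro ⟨c₀, h⟩
    exact ⟨c₀, fun c' hc' => (formulaILongPsiDil_iff_unit c').mp (h c' hc')⟩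
  · rintro ⟨c₀, h⟩
    exact ⟨c₀, fun c' hc' => (formulaILongPsiDil_iff_unit c').mpr (h c' hc')⟩

/-- In particular a proof of the unit-class estimate for EVERY `c′` yields the registered stub (with `c₀ = 0`).
[cite: Zhang2022LandauSiegel, §7 Prop. 7.1 p. 13] -/
theorem stub_formulaILongPsiDil_of_unit
    (h : ∀ c' : ℝ, ∀ ε : ℝ, 0 < ε → ∃ C : ℝ, ForAllLarge fun D _ χ => AssumptionA D χ →
      ∀ (b₀ : ℕ → ℂ) (g g' f f' : ℝ → ℂ) (a₂ : ℕ → ℂ),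
        InClassPiece g g' → InClassPiece f f' →
        (∀ x ∈ Set.Icc (0:ℝ) 1, ‖g x‖ ≤ 1) → (∀ x ∈ Set.Icc (0:ℝ) 1, ‖f x‖ ≤ 1) →
        (∀ n, ‖b₀ n‖ ≤ ((Nat.divisors n).card : ℝ) ^ 2) → (∀ n : ℕ, D ^ 4 < n → b₀ n = 0) →
        (∀ n, ‖a₂ n‖ ≤ ((Nat.divisors n).card : ℝ)) → (∀ n : ℕ, D ^ 4 < n → a₂ n = 0) →
          ‖Theta1Ext c' χ (Nlong D) (Nsupp D) (longPsiData χ (dilHead D b₀) g f) a₂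
              - mainMVExt c' D (Nlong D) (Nsupp D) (longPsiData χ (dilHead D b₀) g f) a₂‖
            ≤ C * EcalExt c' D (Nlong D) (Nsupp D) (longPsiData χ (dilHead D b₀) g f) a₂
              + ε * Real.sqrt D * frakP D) :
    ∃ c₀ : ℝ, ∀ c' : ℝ, c₀ ≤ c' → FormulaILongPsiDil c' :=
  ⟨0, fun c' _ => (formulaILongPsiDil_iff_unit c').mpr (h c')⟩

end UnitClass


/-! ### Part 3 — what K2 (`FormulaILongPsi`) supplies on the dilated class: slack `ε·D·𝔓`, `Adm72` k-side -/

section FromK2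

/-- The class bound of a head is non-negative (test at `n = 1`, `τ(1) = 1`). [cite: Zhang2022LandauSiegel, §7 (7.2) p. 13] -/
theorem head_bound_nonneg {b₀ : ℕ → ℂ} {B : ℝ} (hb : ∀ n, ‖b₀ n‖ ≤ B * ((Nat.divisors n).card : ℝ) ^ 2) :
    0 ≤ B := by
  have h := hb 1
  simp only [Nat.divisors_one, Finset.card_singleton, Nat.cast_one, one_pow, mul_one] at h
  exact (norm_nonneg _).trans h

/-- **A head of the dilated class lies in K2's sup-amplitude class at amplitude `D`:** `‖b₀(n)‖ ≤ B·τ(n)²` for all `n`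
implies `‖dilHead D b₀ (n)‖ ≤ D·B·τ(n)²` for all `n` (`τ(a) ≤ τ(D·a)`). [cite: Zhang2022LandauSiegel, §7 (7.2) p. 13; §8 (8.8) p. 16] -/
theorem dilHead_norm_le {D : ℕ} {b₀ : ℕ → ℂ} {B : ℝ} (hb : ∀ n, ‖b₀ n‖ ≤ B * ((Nat.divisors n).card : ℝ) ^ 2)
    (n : ℕ) : ‖dilHead D b₀ n‖ ≤ (D : ℝ) * B * ((Nat.divisors n).card : ℝ) ^ 2 := by
  have hB : 0 ≤ B := head_bound_nonneg hb
  have hrhs : 0 ≤ (D : ℝ) * B * ((Nat.divisors n).card : ℝ) ^ 2 := by positivity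
  unfold dilHead
  split_ifs with h
  · obtain ⟨a, rfl⟩ := h
    rcases Nat.eq_zero_or_pos D with hD | hD
    · subst hD
      simp
    · rw [Nat.mul_div_cancel_left a hD, norm_mul, Complex.norm_natCast, mul_assoc]
      refine mul_le_mul_of_nonneg_left ((hb a).trans ?_) (Nat.cast_nonneg _)
      rcases Nat.eq_zero_or_pos a with rfl | ha
      · simp
      · have hsub : a.divisors ⊆ (D * a).divisors :=
          Nat.divisors_subset_of_dvd (Nat.pos_iff_ne_zero.mp (Nat.mul_pos hD ha)) (dvd_mul_left a D)
        have hcard : (a.divisors.card : ℝ) ≤ ((D * a).divisors.card : ℝ) := by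
          exact_mod_cast Finset.card_le_card hsub
        exact mul_le_mul_of_nonneg_left (pow_le_pow_left₀ (Nat.cast_nonneg _) hcard 2) hB
  · rw [norm_zero]
    exact hrhs

/-- **K2 on the dilated class (the exact image, for the record next to the stub).** From `FormulaILongPsi c′` (K2: head class
`‖b(n)‖ ≤ B·τ(n)²` supported `≤ D⁵`, k-side `Adm72 D B`, slack `ε·𝔓`) one gets, for heads of the DILATED class
(`b = dilHead D b₀`, `‖b₀(n)‖ ≤ B·τ(n)²`, `b₀` supported `≤ D⁴`) against `Adm72 D B` k-side data, the formula-I estimate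
with slack `ε·D·𝔓` — K2 applied to `D⁻¹·dilHead D b₀` (`dilHead_norm_le`, `dilHead_eq_zero_of_pow_five_lt`; cf.
`LongPairsGradedTables/Negative/LegSplitAmplitude.formulaILongPsi_amp`, p545732, at amplitude `A = D`). The registered stub's slot `FormulaILongPsiDil c′` differs from this image in exactly
two binders: the slack (`ε·√D·𝔓`, not `ε·D·𝔓`) and the k-side class (`‖𝐚₂(n)‖ ≤ B·τ(n)`, support `≤ D⁴`, not
`Adm72 D B`) — neither is reachable from K2 by homogeneity (p545732). [cite: Zhang2022LandauSiegel, §7 Prop. 7.1, (7.2) p. 13;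
§8 (8.8) p. 16] -/
theorem formulaILongPsi_dilHead {c' : ℝ} (h : FormulaILongPsi c') :
    ∀ B : ℝ, ∀ ε : ℝ, 0 < ε → ∃ C : ℝ, ForAllLarge fun D _ χ => AssumptionA D χ →
      ∀ (b₀ : ℕ → ℂ) (g g' f f' : ℝ → ℂ) (a₂ : ℕ → ℂ),
        InClassPiece g g' → InClassPiece f f' →
        (∀ x ∈ Set.Icc (0:ℝ) 1, ‖g x‖ ≤ 1) → (∀ x ∈ Set.Icc (0:ℝ) 1, ‖f x‖ ≤ 1) →
        (∀ n, ‖b₀ n‖ ≤ B * ((Nat.divisors n).card : ℝ) ^ 2) → (∀ n : ℕ, D ^ 4 < n → b₀ n = 0) →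
        Adm72 D B a₂ →
          ‖Theta1Ext c' χ (Nlong D) (Nsupp D) (longPsiData χ (dilHead D b₀) g f) a₂
              - mainMVExt c' D (Nlong D) (Nsupp D) (longPsiData χ (dilHead D b₀) g f) a₂‖
            ≤ C * EcalExt c' D (Nlong D) (Nsupp D) (longPsiData χ (dilHead D b₀) g f) a₂
              + ε * D * frakP D := by
  intro B ε hε
  obtain ⟨C, D₀, hD₀⟩ := h B ε hε
  refine ⟨C, D₀, fun D _ χ hD hq hp hA b₀ g g' f f' a₂ hg hf hg1 hf1 hb hb0 ha₂ => ?_⟩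
  have hDpos : (0 : ℝ) < D := by exact_mod_cast Nat.pos_of_ne_zero (NeZero.ne D)
  -- K2 applied to the head `D⁻¹·dilHead D b₀`, which lies in K2's class with the same `B`
  have hb'1 : ∀ n, ‖(D : ℂ)⁻¹ * dilHead D b₀ n‖ ≤ B * ((Nat.divisors n).card : ℝ) ^ 2 := by
    intro n
    rw [norm_mul, norm_inv, Complex.norm_natCast, inv_mul_le_iff₀ hDpos]
    calc ‖dilHead D b₀ n‖ ≤ (D : ℝ) * B * ((Nat.divisors n).card : ℝ) ^ 2 := dilHead_norm_le hb n
      _ = (D : ℝ) * (B * ((Nat.divisors n).card : ℝ) ^ 2) := by ring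
  have hb'0 : ∀ n : ℕ, D ^ 5 < n → (D : ℂ)⁻¹ * dilHead D b₀ n = 0 := fun n hn => by
    rw [dilHead_eq_zero_of_pow_five_lt b₀ hb0 hn, mul_zero]
  have key := hD₀ D χ hD hq hp hA (fun n => (D : ℂ)⁻¹ * dilHead D b₀ n) g g' f f' a₂ hg hf hg1 hf1 hb'1 hb'0 ha₂
  rw [longPsiData_const_mul_fun', Theta1Ext_const_mul_left', mainMVExt_const_mul_left', EcalExt_const_mul_left',
    ← mul_sub, norm_mul, norm_inv, Complex.norm_natCast] at key
  -- key : D⁻¹·‖Θ − M‖ ≤ C·(D⁻¹·E) + ε·𝔓; multiply through by `D`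
  set T := ‖Theta1Ext c' χ (Nlong D) (Nsupp D) (longPsiData χ (dilHead D b₀) g f) a₂
      - mainMVExt c' D (Nlong D) (Nsupp D) (longPsiData χ (dilHead D b₀) g f) a₂‖ with hT
  set E := EcalExt c' D (Nlong D) (Nsupp D) (longPsiData χ (dilHead D b₀) g f) a₂ with hE
  have hmul := mul_le_mul_of_nonneg_left key hDpos.le
  have h1 : (D : ℝ) * ((D : ℝ)⁻¹ * T) = T := by field_simp
  have h2 : (D : ℝ) * (C * ((D : ℝ)⁻¹ * E) + ε * frakP D) = C * E + ε * D * frakP D := by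
    field_simp
  rwa [h1, h2] at hmul

end FromK2

end Summit.Parity.GeneralizedHardyLittlewood.Theorems

end
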